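import Summits.Langlands.Langlands.Statement
import Literature.NumberTheory.Automorphic.KimExteriorSquareGL4
import HarnessLib

/-!
# Line `ExteriorSquareGL5GaloisToAutomorphic` — ON-PATH FILE (forward generator G4 ladder-down, generation 14)
# top crux `IrreducibilityBySelfDuality.ReciprocityUpToIrreducibility` (stmt-Langlands-14328)

`Langlands → ExteriorSquareGaloisToAutomorphic m` for every `m ≥ 2` (restriction of clause (B) at rank `m(m-1)/2`
to the `Rec` the summit provides: the family's de Rham clause is against `fontainePstAdicCompletion = Rec.pst` by
`rfl`, a.e. unramifiedness is read off the Satake-match hypothesis, cuspidal ⇒ automorphic, `Corresponds` ⊃ a.e.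
Satake), and the `@[aesop safe apply]` instance `ExteriorSquareGL5GaloisToAutomorphic_of_Langlands` used by the
kernel's on-path test.  No `sorry`.
-/

noncomputable section

set_option linter.dupNamespace false

open scoped MatrixGroups Matrix NumberField Classical Polynomial
open Filter IsDedekindDomain Field Polynomial
open Literature.NumberTheory.Automorphic Literature.NumberTheory.GaloisRepresentations
open Literature.NumberTheory.PAdicHodge
open Summit.Langlands

namespace Summit.Langlands.Langlands.Cruxes.ReciprocityUpToIrreducibility.ExteriorSquareGL5GaloisToAutomorphic

/-! ## 2. The graded family (dial = source rank `m` of `∧²`, target rank `m(m-1)/2`) and the rung `m = 5` -/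

/-- **The rung family** `ExteriorSquareGaloisToAutomorphic m`: clause (B) of the summit (Galois ⇒ automorphic) over
EVERY number field `F`, at EVERY `ℓ` and `ι : ℚ̄_ℓ ≃ ℂ`, in the a.e.-Satake form, for irreducible
`ρ : Γ_F → GL_{m(m-1)/2}(ℚ̄_ℓ)` de Rham above `ℓ` (pinned Fontaine datum `fontainePstAdicCompletion`) whose Frobenius
characteristic polynomials are, at all but finitely many places, the `ι`-Satake polynomials of `∧² α_v` for the
Satake parameters `α_v` of a CUSPIDAL `π` on `GL_m(𝔸_F)` — the unramified shadow of "`ρ ≅ ∧² ρ_π`".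
Conclusion: an AUTOMORPHIC `P` on `GL_{m(m-1)/2}(𝔸_F)` (Borel–Jacquet datum, not asserted cuspidal) with
`SatakeFrobCompatibleAt ι P ρ v` for almost all `v`.  Implied by the summit for every `m ≥ 2`
(`exteriorSquareGaloisToAutomorphic_of_langlands`); implied by weak `∧²` functoriality at `m`
(`of_weakExteriorSquareFunctoriality`), hence PROVED at `m = 4` modulo the in-tree named fact (Kim 2003 Thm A) and
elementary at `m = 2, 3`; OPEN at `m = 5` (`GL₅ → GL₁₀`). -/
def ExteriorSquareGaloisToAutomorphic (m : ℕ) : Prop :=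
  ∀ (F : Type) [Field F] [NumberField F]
    (hm : Literature.NumberTheory.Automorphic.isCompact_glFiniteIntegralLevel m F)
    (π : Literature.NumberTheory.Automorphic.CuspidalAutomorphicRepData m F hm)
    (ℓ : ℕ) [Fact ℓ.Prime] (ι : PadicAlgCl ℓ ≃+* ℂ)
    (ρ : Literature.NumberTheory.GaloisRepresentations.FramedGaloisRep F (PadicAlgCl ℓ) (m * (m - 1) / 2)),
    ρ.toGaloisRep.IsIrreducible →
    (∀ (v : IsDedekindDomain.HeightOneSpectrum (NumberField.RingOfIntegers F))
      (hv : ((ℓ : ℕ) : NumberField.RingOfIntegers F) ∈ v.asIdeal),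
      (Literature.NumberTheory.PAdicHodge.fontainePstAdicCompletion v ℓ hv).IsDeRhamFramed (ρ.toLocal v)) →
    (∀ᶠ v : IsDedekindDomain.HeightOneSpectrum (NumberField.RingOfIntegers F) in Filter.cofinite,
      ∃ α : Multiset ℂ, π.1.HasSatakeParamAt v α ∧ ρ.IsUnramifiedAt v ∧
        ρ.HasFrobCharpolyAt v
          (Literature.NumberTheory.Automorphic.arithFrobPolyOfSatake ι v.residueCard 1
            (Literature.NumberTheory.Automorphic.wedgeTwoParams α))) →
    ∀ hcpt : Literature.NumberTheory.Automorphic.isCompact_glFiniteIntegralLevel (m * (m - 1) / 2) F,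
      ∃ P : Literature.NumberTheory.Automorphic.AutomorphicRepData
          (Literature.NumberTheory.Automorphic.AutomorphyDatum.gl (m * (m - 1) / 2) F hcpt),
        ∀ᶠ v : IsDedekindDomain.HeightOneSpectrum (NumberField.RingOfIntegers F) in Filter.cofinite,
          Summit.Langlands.SatakeFrobCompatibleAt ι P ρ v

/-- **THE RUNG** (the filed statement): the family at `m = 5` — clause (B) for irreducible de Rham
`GL₁₀`-representations of exterior-square-of-`GL₅` type over every number field. -/
def ExteriorSquareGL5GaloisToAutomorphic : Prop := ExteriorSquareGaloisToAutomorphic 5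

/-! ## 5. On-path: the summit gives every rung `m ≥ 2` -/

/-- `2 ≤ m → 0 < m * (m - 1) / 2` (the target rank of `∧²` is positive). [folklore] -/
theorem targetRank_pos {m : ℕ} (hm : 2 ≤ m) : 0 < m * (m - 1) / 2 := by
  obtain ⟨k, rfl⟩ : ∃ k, m = k + 2 := ⟨m - 2, by omega⟩
  have h1 : (k + 2) * (k + 2 - 1) = (k + 2) * (k + 1) := by
    congr 1
  rw [h1]
  apply Nat.div_pos _ two_pos
  nlinarith

/-- **Dial monotonicity in the summit direction**: `Langlands → ExteriorSquareGaloisToAutomorphic m` for every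
`m ≥ 2` — clause (B) at rank `m(m-1)/2` over `F` for the reciprocity datum the summit provides; the sector's
de Rham clause is against `Rec.pst` by `rfl`, a.e.-unramifiedness is part of the sector clause, a cuspidal datum
is in particular automorphic and `Corresponds` contains the a.e. Satake clause. -/
theorem exteriorSquareGaloisToAutomorphic_of_langlands (m : ℕ) (hm : 2 ≤ m) (hL : _root_.Langlands) :
    ExteriorSquareGaloisToAutomorphic m := by
  intro F _ _ hmF π ℓ _ ι ρ hirr hdR hsec hcpt
  obtain ⟨⟨Rec⟩, hall⟩ := hL F
  have hB : GaloisToAutomorphic (m * (m - 1) / 2) Rec hcpt :=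
    (hall Rec (m * (m - 1) / 2) (targetRank_pos hm) hcpt).2
  have hgeo : IsGeometricFramed Rec ρ :=
    ⟨hsec.mono fun v ⟨_, _, hur, _⟩ => hur, fun v hv => hdR v hv⟩
  obtain ⟨π', -, hcorr⟩ := hB ℓ ι ρ hirr hgeo
  exact ⟨π'.1, hcorr.1⟩

/-- **F4 on-path lemma for the rung**: `Langlands → ExteriorSquareGL5GaloisToAutomorphic`. -/
@[aesop safe apply]
theorem ExteriorSquareGL5GaloisToAutomorphic_of_Langlands (hL : _root_.Langlands) :
    ExteriorSquareGL5GaloisToAutomorphic :=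
  exteriorSquareGaloisToAutomorphic_of_langlands 5 (by norm_num) hL

end Summit.Langlands.Langlands.Cruxes.ReciprocityUpToIrreducibility.ExteriorSquareGL5GaloisToAutomorphic

end
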